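import Summits.QuantumFields.YangMills.Theorems.BalabanUVNodesN15ColouredLiveBackgroundMatrixRate
import HarnessLib

/-!
# N15 = NE2 — PROGRAMME Q «COVARIANT AVERAGE IN THE SANDWICH», part (Q-1): THE GENERIC SANDWICH LETTERS — block majorants of `Q∘T∘A` and of the two-grid difference
# `Q′∘T′∘A′ − Q∘T∘A` from the rows of the factors, over ANY geometry with Lemma 2.1's row sums (Σ-col (J-a) §3 ∕ (J-b) §2 with the averaging maps ABSTRACT)
# (dag-n15-a g31, FILE (Q-1); node N15 = NE2; `--kind proof --supports stmt-QuantumFields-27366 --as helper`, count-neutral; theorems only, 0 def)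

WHY.  [B9] Thm 3.2 (3.48) p.398 reads the SITE object `(Q′(U)G′²(U)Q′*(U))⁻¹` with the COVARIANT averaging `Q′(U)` ((3.19), contours and transports), and §C p.406 (3.78)–(3.81)
prints its background dependence `Q_j(U′U) = Q_j(U) + F₂,ⱼ(A)`, `|F₂(B)B′| ≤ O(1)·sup|B|·Q″|B′|` — in the global small-field gauge the covariant average is the FLAT one plus a SMALL,
SEMI-LOCAL perturbation.  This lane's U-live site ∕ unit objects ((J-b′) `zLiveC∕F`, (J-c), (L-4), (Ð-4)) sandwich dag-n15-c's live propagator with the flat `Q ⊗ 1_colour`; Σ-col (J-a) §3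
and (J-b) §2 proved the three letters of that sandwich with the rows of `Q ⊗ 1`, `Q* ⊗ 1` WIRED IN (`hasMaj_tensorId_qvRe`, `…qvAdjRe`, part 45, FILE 99).  PROGRAMME Q replaces `Q ⊗ 1` by
`Q ⊗ 1 + D` with `D`'s letters DISPLAYED ((3.81)'s shape); its first step is THIS file: the same two estimates with the averaging maps `Q`, `A` and their two-grid comparison rows as
HYPOTHESES — so that (Q-2) instantiates them three times (`Q_U T Q_U†`, `D (G⊗1) Q_U†`, `(Q⊗1)(G⊗1) D†`) instead of re-running six compositions each time.

WHAT (generic: a geometry `g` with (2.54) and Lemma 2.1's row sums at `ρ∕2` and `ρ∕4`; block-normed spaces `b₂` (coarse), `b₃` (fine), `b_W` (unit); all input rows at ONE rate `ρ`).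
§1 ★★ `hasMaj_sandwich_exp`: `Q : V₂ → W` (`q`), `T : V₂ → V₂` (`t`), `A : W → V₂` (`q′`) ⟹ `HasMaj b_W b_W (Q∘T∘A) (κ₂²·q·t·q′·c₂·c₄·e^{−(ρ∕4)d})`.
§2 ★★★ `hasMaj_sandwich_sub_exp`: with moreover `Q′ : V₃ → W` (`q`), `T′ : V₃ → V₃` (`t`), `A′ : W → V₃` (`q′`) and the three COMPARISON rows along a pairing `P : V₂ → V₃` —
`𝔇_P(T′,T) = T′P − PT` (`τ_T`), `A′ − PA` (`τ_A`), `Q′P − Q` (`τ_Q`) — the two-grid difference `Q′∘T′∘A′ − Q∘T∘A` has the block majorant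
`c₂c₄·(κ₃²·q·t·τ_A + κ₂κ₃·q·q′·τ_T + κ₂²·t·q′·τ_Q)·e^{−(ρ∕4)d}` ((J-b) §1 `sandwich_telescope` + six [B11] `hasMaj_comp_exp`, margins `ρ∕2` then `ρ∕4`).
§3 `hasMaj_sandwich_exp_ofBlocks` ∕ `hasMaj_sandwich_sub_exp_ofBlocks`: the sharp-block editions (`κ = 1`, `kappa_ofBlocks`) in the shape (J-a) §2 `abs_unitBondMatC_le_of_hasMaj` consumes.

HONEST FRAMING ∕ LIMITS.  Finite bookkeeping of block majorants ([B6] (2.52)–(2.56) + Lemma 2.1), nothing else; no object of [B9] constructed, no layer of NE2 proved, no count; the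
covariant average `Q(U)` of [5] (124) is NOT typed here or anywhere in the tree (MISSING ESTIMATE N15 asked 2026-08-29 12:39Z) — PROGRAMME Q displays its letters.  N15 stays DISCHARGED
OF RECORD AS CONSUMED (U-blind v7 pin, p687738); nothing re-claimed.  No `sorry`, `def`, `instance`, `notation`, `set_option`; standard axioms.
[cite: Balaban1984PropagatorsII, (2.52)–(2.56) pp.232–233, Lemma 2.1 (2.61) p.234 (mechanism); Balaban1985BackgroundPropagators, Thm 3.2 (3.48) p.398 (the covariant sandwich: shape), (3.78)–(3.81) p.406 (the perturbation of the
averaging: shape); King1986, Prop. 3.9 (3.73) p.665 (η-rate shape)]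
-/

open scoped BigOperators

namespace Summit.QuantumFields.YangMills.BalabanUVNodes.N15.GluedZeroField

open Literature.MathematicalPhysics.QuantumFieldTheory.Balaban1983to89
open Literature.MathematicalPhysics.QuantumFieldTheory.Balaban1983to89.B6RandomWalk (Triangle254)
open Literature.MathematicalPhysics.QuantumFieldTheory.Balaban1983to89.B11SectG (BlockNorm HasMaj RowSum hasMaj_comp_exp)
open Literature.MathematicalPhysics.QuantumFieldTheory.Balaban1983to89.T4EtaRateDefect (idef)
open Summit.QuantumFields.YangMills.BalabanUVNodes.N15.BackgroundModel (kappa_ofBlocks)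
open Summit.QuantumFields.YangMills.BalabanUVNodes.N15.SiteLayer (hasMaj_exp_mono)

variable {g : B6.Geometry} {V₂ V₃ W : Type} [AddCommGroup V₂] [Module ℝ V₂] [AddCommGroup V₃] [Module ℝ V₃] [AddCommGroup W] [Module ℝ W]
  {b₂ : BlockNorm g V₂} {b₃ : BlockNorm g V₃} {bW : BlockNorm g W}

/-! ## §1 One sandwich -/

/-- ★★ **THE SANDWICH LETTER**: `Q` (`V₂ → W`, majorant `q·e^{−ρd}`), `T` (`V₂ → V₂`, `t·e^{−ρd}`), `A` (`W → V₂`, `q′·e^{−ρd}`), all rates `ρ ≥ 0`, Lemma 2.1's row sums at `ρ∕2`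
(constant `c₂ ≥ 0`) and `ρ∕4` (`c₄`) ⟹ `Q∘T∘A` has the block majorant `κ₂²·q·t·q′·c₂·c₄·e^{−(ρ∕4)d}` (two [B11] compositions: `T∘A` at rate `ρ∕2`, then `Q∘(T∘A)` at `ρ∕4`).
[cite: Balaban1984PropagatorsII, (2.52)–(2.56) pp.232–233, Lemma 2.1 (2.61) p.234] -/
theorem hasMaj_sandwich_exp (htri : Triangle254 g) (hd : ∀ a b : g.Site, 0 ≤ g.dist a b) {ρ c₂ c₄ : ℝ} (hρ : 0 ≤ ρ) (hc₂ : 0 ≤ c₂) (hrow₂ : RowSum g (ρ / 2) c₂) (hrow₄ : RowSum g (ρ / 4) c₄)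
    {Q : V₂ →ₗ[ℝ] W} {T : V₂ →ₗ[ℝ] V₂} {A : W →ₗ[ℝ] V₂} {q t q' : ℝ} (hq : 0 ≤ q) (ht : 0 ≤ t) (hq' : 0 ≤ q')
    (hQ : HasMaj b₂ bW Q (fun y y' => q * Real.exp (-(ρ * g.dist y y')))) (hT : HasMaj b₂ b₂ T (fun y y' => t * Real.exp (-(ρ * g.dist y y'))))
    (hA : HasMaj bW b₂ A (fun y y' => q' * Real.exp (-(ρ * g.dist y y')))) :
    HasMaj bW bW (Q ∘ₗ T ∘ₗ A) (fun y y' => b₂.κ * b₂.κ * q * t * q' * c₂ * c₄ * Real.exp (-(ρ / 4 * g.dist y y'))) := by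
  have h1 := hasMaj_comp_exp (ρ := ρ / 2) (σ := ρ / 2) htri hd hrow₂ ht hq' (by positivity) (by linarith) (by linarith) hT hA
  have h2 := hasMaj_comp_exp (ρ := ρ / 4) (σ := ρ / 4) htri hd hrow₄ hq (mul_nonneg (mul_nonneg (mul_nonneg b₂.κ_nonneg ht) hq') hc₂) (by positivity) (by linarith) (by linarith) hQ h1
  exact h2.mono fun y y' => le_of_eq (by ring)

/-! ## §2 The two-grid difference of two sandwiches -/

/-- ★★★ **THE η-DIFFERENCE LETTER OF THE SANDWICH**: `Q, T, A` as in §1 on the coarse space `V₂`, `Q′, T′, A′` likewise on the fine space `V₃` (same sizes `q, t, q′`, rate `ρ`), a pairing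
`P : V₂ → V₃`, and the three COMPARISON rows at rate `ρ` — `𝔇_P(T′,T) = T′∘P − P∘T` (`τ_T`), `A′ − P∘A` (`τ_A`), `Q′∘P − Q` (`τ_Q`) ⟹ `Q′∘T′∘A′ − Q∘T∘A` has the block majorant
`c₂·c₄·(κ₃²·q·t·τ_A + κ₂·κ₃·q·q′·τ_T + κ₂²·t·q′·τ_Q)·e^{−(ρ∕4)d}` — (J-b) §1's telescoping `Q′T′A′ − QTA = Q′∘(T′∘(A′ − PA)) + Q′∘(𝔇∘A) + (Q′P − Q)∘(T∘A)` and six [B11]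
compositions (inner at `ρ∕2`, outer at `ρ∕4`). [cite: Balaban1984PropagatorsII, (2.52)–(2.56) pp.232–233, Lemma 2.1 (2.61) p.234; King1986, Prop. 3.9 (3.73) p.665 (η-rate shape)] -/
theorem hasMaj_sandwich_sub_exp (htri : Triangle254 g) (hd : ∀ a b : g.Site, 0 ≤ g.dist a b) {ρ c₂ c₄ : ℝ} (hρ : 0 ≤ ρ) (hc₂ : 0 ≤ c₂) (hrow₂ : RowSum g (ρ / 2) c₂) (hrow₄ : RowSum g (ρ / 4) c₄)
    {Qf : V₃ →ₗ[ℝ] W} {Qc : V₂ →ₗ[ℝ] W} {T' : V₃ →ₗ[ℝ] V₃} {T : V₂ →ₗ[ℝ] V₂} {Af : W →ₗ[ℝ] V₃} {Ac : W →ₗ[ℝ] V₂} {P : V₂ →ₗ[ℝ] V₃}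
    {q t q' τT τA τQ : ℝ} (hq : 0 ≤ q) (ht : 0 ≤ t) (hq' : 0 ≤ q') (hτT : 0 ≤ τT) (hτA : 0 ≤ τA) (hτQ : 0 ≤ τQ)
    (hQf : HasMaj b₃ bW Qf (fun y y' => q * Real.exp (-(ρ * g.dist y y')))) (hT' : HasMaj b₃ b₃ T' (fun y y' => t * Real.exp (-(ρ * g.dist y y'))))
    (hT : HasMaj b₂ b₂ T (fun y y' => t * Real.exp (-(ρ * g.dist y y')))) (hAc : HasMaj bW b₂ Ac (fun y y' => q' * Real.exp (-(ρ * g.dist y y'))))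
    (hD : HasMaj b₂ b₃ (idef P P T' T) (fun y y' => τT * Real.exp (-(ρ * g.dist y y'))))
    (hAd : HasMaj bW b₃ (Af - P ∘ₗ Ac) (fun y y' => τA * Real.exp (-(ρ * g.dist y y'))))
    (hQd : HasMaj b₂ bW (Qf ∘ₗ P - Qc) (fun y y' => τQ * Real.exp (-(ρ * g.dist y y')))) :
    HasMaj bW bW (Qf ∘ₗ T' ∘ₗ Af - Qc ∘ₗ T ∘ₗ Ac)
      (fun y y' => c₂ * c₄ * (b₃.κ * b₃.κ * q * t * τA + b₂.κ * b₃.κ * q * q' * τT + b₂.κ * b₂.κ * t * q' * τQ) * Real.exp (-(ρ / 4 * g.dist y y'))) := by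
  -- piece 1: `Q′∘(T′∘(A′ − PA))`
  have h1a := hasMaj_comp_exp (ρ := ρ / 2) (σ := ρ / 2) htri hd hrow₂ ht hτA (by positivity) (by linarith) (by linarith) hT' hAd
  have h1 := hasMaj_comp_exp (ρ := ρ / 4) (σ := ρ / 4) htri hd hrow₄ hq (mul_nonneg (mul_nonneg (mul_nonneg b₃.κ_nonneg ht) hτA) hc₂) (by positivity) (by linarith) (by linarith) hQf h1a
  -- piece 2: `Q′∘(𝔇∘A)`
  have h2a := hasMaj_comp_exp (ρ := ρ / 2) (σ := ρ / 2) htri hd hrow₂ hτT hq' (by positivity) (by linarith) (by linarith) hD hAc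
  have h2 := hasMaj_comp_exp (ρ := ρ / 4) (σ := ρ / 4) htri hd hrow₄ hq (mul_nonneg (mul_nonneg (mul_nonneg b₂.κ_nonneg hτT) hq') hc₂) (by positivity) (by linarith) (by linarith) hQf h2a
  -- piece 3: `(Q′P − Q)∘(T∘A)`
  have h3a := hasMaj_comp_exp (ρ := ρ / 2) (σ := ρ / 2) htri hd hrow₂ ht hq' (by positivity) (by linarith) (by linarith) hT hAc
  have h3 := hasMaj_comp_exp (ρ := ρ / 4) (σ := ρ / 4) htri hd hrow₄ hτQ (mul_nonneg (mul_nonneg (mul_nonneg b₂.κ_nonneg ht) hq') hc₂) (by positivity) (by linarith) (by linarith) hQd h3a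
  have hsum := h1.add (h2.add h3)
  rw [sandwich_telescope Qf Qc T' T Af Ac P]
  exact hsum.mono fun y y' => le_of_eq (by ring)

/-! ## §3 Sharp-block editions (`κ = 1`) -/

variable {X₂ X₃ XW : Type} [Fintype X₂] [Fintype X₃] [Fintype XW] {blk₂ : X₂ → g.Site} {blk₃ : X₃ → g.Site} {blkW : XW → g.Site}

/-- ★★ §1 on sharp blocks (`BlockNorm.ofBlocks`, `κ = 1`): `Q∘T∘A` has the block majorant `q·t·q′·c₂·c₄·e^{−(ρ∕4)d}`. [cite: Balaban1984PropagatorsII, (2.52)–(2.56) pp.232–233] -/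
theorem hasMaj_sandwich_exp_ofBlocks (htri : Triangle254 g) (hd : ∀ a b : g.Site, 0 ≤ g.dist a b) {ρ c₂ c₄ : ℝ} (hρ : 0 ≤ ρ) (hc₂ : 0 ≤ c₂) (hrow₂ : RowSum g (ρ / 2) c₂) (hrow₄ : RowSum g (ρ / 4) c₄)
    {Q : (X₂ → ℝ) →ₗ[ℝ] (XW → ℝ)} {T : (X₂ → ℝ) →ₗ[ℝ] (X₂ → ℝ)} {A : (XW → ℝ) →ₗ[ℝ] (X₂ → ℝ)} {q t q' : ℝ} (hq : 0 ≤ q) (ht : 0 ≤ t) (hq' : 0 ≤ q')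
    (hQ : HasMaj (BlockNorm.ofBlocks g blk₂) (BlockNorm.ofBlocks g blkW) Q (fun y y' => q * Real.exp (-(ρ * g.dist y y'))))
    (hT : HasMaj (BlockNorm.ofBlocks g blk₂) (BlockNorm.ofBlocks g blk₂) T (fun y y' => t * Real.exp (-(ρ * g.dist y y'))))
    (hA : HasMaj (BlockNorm.ofBlocks g blkW) (BlockNorm.ofBlocks g blk₂) A (fun y y' => q' * Real.exp (-(ρ * g.dist y y')))) :
    HasMaj (BlockNorm.ofBlocks g blkW) (BlockNorm.ofBlocks g blkW) (Q ∘ₗ T ∘ₗ A) (fun y y' => q * t * q' * c₂ * c₄ * Real.exp (-(ρ / 4 * g.dist y y'))) :=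
  (hasMaj_sandwich_exp htri hd hρ hc₂ hrow₂ hrow₄ hq ht hq' hQ hT hA).mono fun y y' => le_of_eq (by rw [kappa_ofBlocks]; ring)

/-- ★★★ §2 on sharp blocks (`κ = 1`): `Q′∘T′∘A′ − Q∘T∘A` has the block majorant `c₂·c₄·(q·t·τ_A + q·q′·τ_T + t·q′·τ_Q)·e^{−(ρ∕4)d}`.
[cite: Balaban1984PropagatorsII, (2.52)–(2.56) pp.232–233; King1986, Prop. 3.9 (3.73) p.665 (η-rate shape)] -/
theorem hasMaj_sandwich_sub_exp_ofBlocks (htri : Triangle254 g) (hd : ∀ a b : g.Site, 0 ≤ g.dist a b) {ρ c₂ c₄ : ℝ} (hρ : 0 ≤ ρ) (hc₂ : 0 ≤ c₂) (hrow₂ : RowSum g (ρ / 2) c₂) (hrow₄ : RowSum g (ρ / 4) c₄)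
    {Qf : (X₃ → ℝ) →ₗ[ℝ] (XW → ℝ)} {Qc : (X₂ → ℝ) →ₗ[ℝ] (XW → ℝ)} {T' : (X₃ → ℝ) →ₗ[ℝ] (X₃ → ℝ)} {T : (X₂ → ℝ) →ₗ[ℝ] (X₂ → ℝ)} {Af : (XW → ℝ) →ₗ[ℝ] (X₃ → ℝ)}
    {Ac : (XW → ℝ) →ₗ[ℝ] (X₂ → ℝ)} {P : (X₂ → ℝ) →ₗ[ℝ] (X₃ → ℝ)} {q t q' τT τA τQ : ℝ} (hq : 0 ≤ q) (ht : 0 ≤ t) (hq' : 0 ≤ q') (hτT : 0 ≤ τT) (hτA : 0 ≤ τA) (hτQ : 0 ≤ τQ)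
    (hQf : HasMaj (BlockNorm.ofBlocks g blk₃) (BlockNorm.ofBlocks g blkW) Qf (fun y y' => q * Real.exp (-(ρ * g.dist y y'))))
    (hT' : HasMaj (BlockNorm.ofBlocks g blk₃) (BlockNorm.ofBlocks g blk₃) T' (fun y y' => t * Real.exp (-(ρ * g.dist y y'))))
    (hT : HasMaj (BlockNorm.ofBlocks g blk₂) (BlockNorm.ofBlocks g blk₂) T (fun y y' => t * Real.exp (-(ρ * g.dist y y'))))
    (hAc : HasMaj (BlockNorm.ofBlocks g blkW) (BlockNorm.ofBlocks g blk₂) Ac (fun y y' => q' * Real.exp (-(ρ * g.dist y y'))))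
    (hD : HasMaj (BlockNorm.ofBlocks g blk₂) (BlockNorm.ofBlocks g blk₃) (idef P P T' T) (fun y y' => τT * Real.exp (-(ρ * g.dist y y'))))
    (hAd : HasMaj (BlockNorm.ofBlocks g blkW) (BlockNorm.ofBlocks g blk₃) (Af - P ∘ₗ Ac) (fun y y' => τA * Real.exp (-(ρ * g.dist y y'))))
    (hQd : HasMaj (BlockNorm.ofBlocks g blk₂) (BlockNorm.ofBlocks g blkW) (Qf ∘ₗ P - Qc) (fun y y' => τQ * Real.exp (-(ρ * g.dist y y')))) :
    HasMaj (BlockNorm.ofBlocks g blkW) (BlockNorm.ofBlocks g blkW) (Qf ∘ₗ T' ∘ₗ Af - Qc ∘ₗ T ∘ₗ Ac)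
      (fun y y' => c₂ * c₄ * (q * t * τA + q * q' * τT + t * q' * τQ) * Real.exp (-(ρ / 4 * g.dist y y'))) :=
  (hasMaj_sandwich_sub_exp htri hd hρ hc₂ hrow₂ hrow₄ hq ht hq' hτT hτA hτQ hQf hT' hT hAc hD hAd hQd).mono fun y y' =>
    le_of_eq (by rw [kappa_ofBlocks, kappa_ofBlocks]; ring)

end Summit.QuantumFields.YangMills.BalabanUVNodes.N15.GluedZeroField
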